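import Summits.QuantumFields.YangMills.Theorems.FluctuationComparisonRegPrIntLS2BetaChartReadDescentChainRule
import Mathlib.Algebra.Order.BigOperators.Group.Finset
import HarnessLib

/-!
# S2β · (β-6) THE k-STEP DERIVATIVE PROPAGATES IN `ℓ¹` WITH THE PRODUCT OF THE ONE-STEP `ℓ¹→ℓ¹` CONSTANTS: `Σ_B ‖(DΨ_k(0) X) B‖ ≤ (Π_{i<k} A_i)·Σ_b ‖X b‖` — the (P) letter's
# k-step half over (D0) ✓`fderiv_chartRead_iter_succ_apply`, PARAMETRIC in the one-step letters `Σ_{c′} ‖(Dψ_{Ū^i U₀}(0) Y) c′‖ ≤ A_i·Σ_c ‖Y c‖` (px20 g23's (P′) supplies them)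

Cell `ym3-torus` (YM ladder rung R3 = continuum `SU(2)` Yang–Mills on the three-torus at fixed lattice data — a RUNG: NOT d = 4, NOT infinite volume, NOT a mass gap,
NOT Clay).  Width seat `ym3-torus-px13` (gen 26); crux `stmt-QuantumFields-20520`, LINE g18-1 S2β, pairing lane, AVG₂♭-ax_q ∕ `hLoc` assembly (px16 g22 16:14:08Z): by Q7's telescope
✓p827759 `DMq η = Σ_t T_t(S_t η⁽ᵗ⁺¹⁾ − η⁽ᵗ⁾)` the assembly needs (P) an `ℓ¹→ℓ¹` bound on the PROPAGATORS `T_t = DMq_{J←J+t}` — the k-step chart-read derivative `DΨ_t(0)` of this lineage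
((D0) ✓p824574, (D2) ✓p825421 is its sup→sup form `A·L^k`, which overshoots in `ℓ¹`, px20 g23 15:57:05Z (iii)).  THIS FILE is the k-step half of (P): the product bound over (D0)'s
factorisation, with the one-step `ℓ¹→ℓ¹` constants `A_i` as HYPOTHESES (plain inequalities — px20 g23's (P′) «column sum» count supplies them: flat `A = 1 − L^{−d} + L^{1−d}` + `O(ℓα_i)`).
`--kind proof --supports stmt-QuantumFields-20520 --as helper`, count-neutral, DEFINITION-FREE.

OBJECTS (written out; generic `P : Params`, `SU(N)`): `Ψ_k(A)(c) = Λ(Ū^k(Θ^B(A)·U₀)(c)·Ū^k(U₀)(c)⁻¹)` the k-step chart-read iterate of ✓p823800 (`Ū^k = Averaging.iter (blockAvg expMeanLogSU) k`),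
`ψ_{V}(B)(c′) = Λ(Ū(Θ^B(B)·V)(c′)·Ū(V)(c′)⁻¹)` the one-step chart-read at `V = Ū^i U₀`; `SmallBelow … k U₀` = the (0.4) guard at every level `< k` (lit `Node00.SmallBelow`); norms are the
`𝔰𝔲(N)`-subtype norms (`= ‖↑·‖` in `M_N(ℂ)`, `Submodule.norm_coe`).

WHAT IS PROVED (sorry-free).
* §1 `sum_norm_fderiv_chartRead_iter_zero` (`k = 0`: `DΨ_0 = id`, equality), ★★★`sum_norm_fderiv_chartRead_iter_le` — under `SmallBelow … k U₀` and the one-step `ℓ¹` letters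
  `hone : ∀ i < k, ∀ Y, Σ_{c′} ‖(Dψ_{Ū^i U₀}(0) Y) c′‖ ≤ A i · Σ_c ‖Y c‖` (`0 ≤ A i`):  **`Σ_{B : PBond P k} ‖(DΨ_k(0) X) B‖ ≤ (Π_{i<k} A i)·Σ_b ‖X b‖`** for every `X`;
  ★★`sum_norm_fderiv_chartRead_iter_le_pow` — constant letters `A i = A`: `≤ A^k·Σ_b ‖X b‖`; ★★`sum_norm_fderiv_chartRead_iter_le_exp` — `A i = A·(1 + c·α i)` with `A, c, α ≥ 0`:
  `≤ A^k·exp(c·Σ_{i<k} α i)·Σ_b ‖X b‖` (the (D2)-style history envelope, depth-free once `Σα` is bounded — BKG makes it geometric).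

HONEST.  `ℓ¹` bookkeeping over (D0)'s chain rule; the one-step constants are HYPOTHESES here (px20 g23's (P′) pen); nothing of Bałaban's ((139)–(147) run the analogous induction in
sup norm); (P) as a tree theorem = this file ∘ (P′); AVG₂♭-ax_q ∕ `hLoc`, «MULT♭-ax»∕«CRIT-ax», (D-ax), GAP♯∘ (registry UNTOUCHED), the five REGISTERED stubs, S2β, crux 20520, 19936,
19200, `YM3TorusSU2` — NOT proved; rung R3 = SU(2) YM₃ on T³ at fixed lattice data — NOT d = 4, NOT infinite volume, NOT a mass gap, NOT Clay; the Yang–Mills mass gap is NOT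
proved.  Axioms standard.

References: [Balaban1985Averaging] CMP **98** (1985) Prop. 4 (127)–(128) p.37, (139)–(147) pp.39–40; [Balaban1987RG1] CMP **109** (1987) (0.11) p.253.
-/

set_option autoImplicit false

noncomputable section

open scoped Matrix.Norms.L2Operator Topology BigOperators
open Filter Set Function Finset

namespace Summit.QuantumFields.YangMills.Theorems.FluctuationComparisonRegPrIntLS2BetaChartReadDerivKStepL1

open Literature.MathematicalPhysics.QuantumFieldTheory.Balaban1983to89
open Literature.MathematicalPhysics.QuantumFieldTheory.Balaban1983to89.HaarExponentialChart
open Literature.MathematicalPhysics.QuantumFieldTheory.Balaban1983to89.HaarExponentialChart.IsChartRep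
open Literature.MathematicalPhysics.QuantumFieldTheory.Balaban1983to89.BlockAveraging (Small Idx avgFun loopHol blockAvg)
open Literature.MathematicalPhysics.QuantumFieldTheory.Balaban1983to89.ExpMeanLog (expMeanLogSU deltaSU)
open Literature.MathematicalPhysics.QuantumFieldTheory.Balaban1983to89.Node00
open Summit.QuantumFields.YangMills.Theorems.FluctuationComparisonRegPrIntLS2BetaChartReadDescentChainRule

variable {P : Params} {N : ℕ} [NeZero N] (U₀ : GaugeField P 0 (SU N))

/-! ## §1 The product bound -/

section Product

/-- `k = 0`: `DΨ_0(0) = id`, so the `ℓ¹` norm is preserved exactly. [cite: Balaban1987RG1, (0.11) p.253 (bookkeeping)] -/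
theorem sum_norm_fderiv_chartRead_iter_zero (X : PBond P 0 → (specialUnitaryLogChart (Fin N)).lie) :
    ∑ B : PBond P 0, ‖fderiv ℝ (fun (A : PBond P 0 → (specialUnitaryLogChart (Fin N)).lie) (c : PBond P 0) => (isChartRep_specialUnitaryGroup (n := Fin N)).logChart (Averaging.iter (fun i => blockAvg (P := P) (j := i) (expMeanLogSU (n := Fin N))) 0 (fun b => (isChartRep_specialUnitaryGroup (n := Fin N)).expChart (A b) * U₀ b) c * (Averaging.iter (fun i => blockAvg (P := P) (j := i) (expMeanLogSU (n := Fin N))) 0 U₀ c)⁻¹)) 0 X B‖ = ∑ b : PBond P 0, ‖X b‖ := by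
  rw [fderiv_chartRead_iter_zero (P := P) (N := N) U₀, ContinuousLinearMap.id_apply]

/-- ★★★ **THE k-STEP DERIVATIVE PROPAGATES IN `ℓ¹` WITH THE PRODUCT OF THE ONE-STEP CONSTANTS.**  Under the (0.4) guard at every level `< k` and the one-step `ℓ¹→ℓ¹` letters
`Σ_{c′} ‖(Dψ_{Ū^i U₀}(0) Y) c′‖ ≤ A i·Σ_c ‖Y c‖` (`i < k`, every `Y`, `0 ≤ A i`):  `Σ_B ‖(DΨ_k(0) X) B‖ ≤ (Π_{i<k} A i)·Σ_b ‖X b‖` for every `X`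
(induction over (D0) ✓`fderiv_chartRead_iter_succ_apply`: `DΨ_{i+1}(0) X = Dψ_{Ū^i U₀}(0)(DΨ_i(0) X)`). [cite: Balaban1985Averaging, Prop. 4 (139)-(147) pp.39-40; Balaban1987RG1, (0.11) p.253] -/
theorem sum_norm_fderiv_chartRead_iter_le (k : ℕ)
    (hsb : SmallBelow (fun i => blockAvg (P := P) (j := i) (expMeanLogSU (n := Fin N))) k U₀) {A : ℕ → ℝ} (hA0 : ∀ i, 0 ≤ A i)
    (hone : ∀ i, i < k → ∀ Y : PBond P i → (specialUnitaryLogChart (Fin N)).lie,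
      ∑ c' : PBond P (i + 1), ‖fderiv ℝ (fun (B : PBond P i → (specialUnitaryLogChart (Fin N)).lie) (c' : PBond P (i + 1)) => (isChartRep_specialUnitaryGroup (n := Fin N)).logChart (avgFun (expMeanLogSU (n := Fin N)) (fun c => (isChartRep_specialUnitaryGroup (n := Fin N)).expChart (B c) * Averaging.iter (fun i => blockAvg (P := P) (j := i) (expMeanLogSU (n := Fin N))) i U₀ c) c' * (avgFun (expMeanLogSU (n := Fin N)) (Averaging.iter (fun i => blockAvg (P := P) (j := i) (expMeanLogSU (n := Fin N))) i U₀) c')⁻¹)) 0 Y c'‖ ≤ A i * ∑ c : PBond P i, ‖Y c‖)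
    (X : PBond P 0 → (specialUnitaryLogChart (Fin N)).lie) :
    ∑ B : PBond P k, ‖fderiv ℝ (fun (A : PBond P 0 → (specialUnitaryLogChart (Fin N)).lie) (c : PBond P k) => (isChartRep_specialUnitaryGroup (n := Fin N)).logChart (Averaging.iter (fun i => blockAvg (P := P) (j := i) (expMeanLogSU (n := Fin N))) k (fun b => (isChartRep_specialUnitaryGroup (n := Fin N)).expChart (A b) * U₀ b) c * (Averaging.iter (fun i => blockAvg (P := P) (j := i) (expMeanLogSU (n := Fin N))) k U₀ c)⁻¹)) 0 X B‖ ≤ (∏ i ∈ Finset.range k, A i) * ∑ b : PBond P 0, ‖X b‖ := by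
  induction k with
  | zero =>
    rw [sum_norm_fderiv_chartRead_iter_zero (P := P) (N := N) U₀ X, Finset.prod_range_zero, one_mul]
  | succ k ih =>
    have hsbk : SmallBelow (fun i => blockAvg (P := P) (j := i) (expMeanLogSU (n := Fin N))) k U₀ := hsb.mono (Nat.le_succ k)
    have ih' := ih hsbk (fun i hi Y => hone i (Nat.lt_succ_of_lt hi) Y)
    have hstep := hone k (Nat.lt_succ_self k)
      (fderiv ℝ (fun (A : PBond P 0 → (specialUnitaryLogChart (Fin N)).lie) (c : PBond P k) => (isChartRep_specialUnitaryGroup (n := Fin N)).logChart (Averaging.iter (fun i => blockAvg (P := P) (j := i) (expMeanLogSU (n := Fin N))) k (fun b => (isChartRep_specialUnitaryGroup (n := Fin N)).expChart (A b) * U₀ b) c * (Averaging.iter (fun i => blockAvg (P := P) (j := i) (expMeanLogSU (n := Fin N))) k U₀ c)⁻¹)) 0 X)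
    have heq : ∀ B : PBond P (k + 1), fderiv ℝ (fun (A : PBond P 0 → (specialUnitaryLogChart (Fin N)).lie) (c : PBond P (k + 1)) => (isChartRep_specialUnitaryGroup (n := Fin N)).logChart (Averaging.iter (fun i => blockAvg (P := P) (j := i) (expMeanLogSU (n := Fin N))) (k + 1) (fun b => (isChartRep_specialUnitaryGroup (n := Fin N)).expChart (A b) * U₀ b) c * (Averaging.iter (fun i => blockAvg (P := P) (j := i) (expMeanLogSU (n := Fin N))) (k + 1) U₀ c)⁻¹)) 0 X B =
        fderiv ℝ (fun (B : PBond P k → (specialUnitaryLogChart (Fin N)).lie) (c' : PBond P (k + 1)) => (isChartRep_specialUnitaryGroup (n := Fin N)).logChart (avgFun (expMeanLogSU (n := Fin N)) (fun c => (isChartRep_specialUnitaryGroup (n := Fin N)).expChart (B c) * Averaging.iter (fun i => blockAvg (P := P) (j := i) (expMeanLogSU (n := Fin N))) k U₀ c) c' * (avgFun (expMeanLogSU (n := Fin N)) (Averaging.iter (fun i => blockAvg (P := P) (j := i) (expMeanLogSU (n := Fin N))) k U₀) c')⁻¹)) 0 (fderiv ℝ (fun (A : PBond P 0 → (specialUnitaryLogChart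 (Fin N)).lie) (c : PBond P k) => (isChartRep_specialUnitaryGroup (n := Fin N)).logChart (Averaging.iter (fun i => blockAvg (P := P) (j := i) (expMeanLogSU (n := Fin N))) k (fun b => (isChartRep_specialUnitaryGroup (n := Fin N)).expChart (A b) * U₀ b) c * (Averaging.iter (fun i => blockAvg (P := P) (j := i) (expMeanLogSU (n := Fin N))) k U₀ c)⁻¹)) 0 X) B := fun B => by
      rw [fderiv_chartRead_iter_succ_apply (P := P) (N := N) U₀ k hsb X]
    calc ∑ B : PBond P (k + 1), ‖fderiv ℝ (fun (A : PBond P 0 → (specialUnitaryLogChart (Fin N)).lie) (c : PBond P (k + 1)) => (isChartRep_specialUnitaryGroup (n := Fin N)).logChart (Averaging.iter (fun i => blockAvg (P := P) (j := i) (expMeanLogSU (n := Fin N))) (k + 1) (fun b => (isChartRep_specialUnitaryGroup (n := Fin N)).expChart (A b) * U₀ b) c * (Averaging.iter (fun i => blockAvg (P := P) (j := i) (expMeanLogSU (n := Fin N))) (k + 1) U₀ c)⁻¹)) 0 X B‖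
        = ∑ B : PBond P (k + 1), ‖fderiv ℝ (fun (B : PBond P k → (specialUnitaryLogChart (Fin N)).lie) (c' : PBond P (k + 1)) => (isChartRep_specialUnitaryGroup (n := Fin N)).logChart (avgFun (expMeanLogSU (n := Fin N)) (fun c => (isChartRep_specialUnitaryGroup (n := Fin N)).expChart (B c) * Averaging.iter (fun i => blockAvg (P := P) (j := i) (expMeanLogSU (n := Fin N))) k U₀ c) c' * (avgFun (expMeanLogSU (n := Fin N)) (Averaging.iter (fun i => blockAvg (P := P) (j := i) (expMeanLogSU (n := Fin N))) k U₀) c')⁻¹)) 0 (fderiv ℝ (fun (A : PBond P 0 → (specialUnitaryLogChart (Fin N)).lie) (c : PBond P k) => (isChartRep_specialUnitaryGroup (n := Fin N)).logChart (Averaging.iter (fun i => blockAvg (P := P) (j := i) (expMeanLogSU (n := Fin N))) k (fun b => (isChartRep_specialUnitaryGroup (n := Fin N)).expChart (A b) * U₀ b) c * (Averaging.iter (fun i => blockAvg (P := P) (j := i) (expMeanLogSU (n := Fin N))) k U₀ c)⁻¹)) 0 X) B‖ := Finset.sum_congr rfl fun B _ => by rw [heq B]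
      _ ≤ A k * ∑ c : PBond P k, ‖fderiv ℝ (fun (A : PBond P 0 → (specialUnitaryLogChart (Fin N)).lie) (c : PBond P k) => (isChartRep_specialUnitaryGroup (n := Fin N)).logChart (Averaging.iter (fun i => blockAvg (P := P) (j := i) (expMeanLogSU (n := Fin N))) k (fun b => (isChartRep_specialUnitaryGroup (n := Fin N)).expChart (A b) * U₀ b) c * (Averaging.iter (fun i => blockAvg (P := P) (j := i) (expMeanLogSU (n := Fin N))) k U₀ c)⁻¹)) 0 X c‖ := hstep
      _ ≤ A k * ((∏ i ∈ Finset.range k, A i) * ∑ b : PBond P 0, ‖X b‖) := mul_le_mul_of_nonneg_left ih' (hA0 k)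
      _ = (∏ i ∈ Finset.range (k + 1), A i) * ∑ b : PBond P 0, ‖X b‖ := by rw [Finset.prod_range_succ]; ring

/-- ★★ Constant one-step letters `A i = A`: `Σ_B ‖(DΨ_k(0) X) B‖ ≤ A^k·Σ_b ‖X b‖`. [cite: Balaban1985Averaging, Prop. 4 (147) p.40] -/
theorem sum_norm_fderiv_chartRead_iter_le_pow (k : ℕ)
    (hsb : SmallBelow (fun i => blockAvg (P := P) (j := i) (expMeanLogSU (n := Fin N))) k U₀) {A : ℝ} (hA0 : 0 ≤ A)
    (hone : ∀ i, i < k → ∀ Y : PBond P i → (specialUnitaryLogChart (Fin N)).lie,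
      ∑ c' : PBond P (i + 1), ‖fderiv ℝ (fun (B : PBond P i → (specialUnitaryLogChart (Fin N)).lie) (c' : PBond P (i + 1)) => (isChartRep_specialUnitaryGroup (n := Fin N)).logChart (avgFun (expMeanLogSU (n := Fin N)) (fun c => (isChartRep_specialUnitaryGroup (n := Fin N)).expChart (B c) * Averaging.iter (fun i => blockAvg (P := P) (j := i) (expMeanLogSU (n := Fin N))) i U₀ c) c' * (avgFun (expMeanLogSU (n := Fin N)) (Averaging.iter (fun i => blockAvg (P := P) (j := i) (expMeanLogSU (n := Fin N))) i U₀) c')⁻¹)) 0 Y c'‖ ≤ A * ∑ c : PBond P i, ‖Y c‖)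
    (X : PBond P 0 → (specialUnitaryLogChart (Fin N)).lie) :
    ∑ B : PBond P k, ‖fderiv ℝ (fun (A : PBond P 0 → (specialUnitaryLogChart (Fin N)).lie) (c : PBond P k) => (isChartRep_specialUnitaryGroup (n := Fin N)).logChart (Averaging.iter (fun i => blockAvg (P := P) (j := i) (expMeanLogSU (n := Fin N))) k (fun b => (isChartRep_specialUnitaryGroup (n := Fin N)).expChart (A b) * U₀ b) c * (Averaging.iter (fun i => blockAvg (P := P) (j := i) (expMeanLogSU (n := Fin N))) k U₀ c)⁻¹)) 0 X B‖ ≤ A ^ k * ∑ b : PBond P 0, ‖X b‖ := by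
  have h := sum_norm_fderiv_chartRead_iter_le (P := P) (N := N) U₀ k hsb (A := fun _ => A) (fun _ => hA0) hone X
  rwa [Finset.prod_const, Finset.card_range] at h

/-- ★★ History-weighted one-step letters `A i = A·(1 + c·α i)` (`A, c, α ≥ 0`): `Σ_B ‖(DΨ_k(0) X) B‖ ≤ A^k·exp(c·Σ_{i<k} α i)·Σ_b ‖X b‖` — depth-free once `Σα` is bounded.
[cite: Balaban1985Averaging, Prop. 4 (147) p.40] -/
theorem sum_norm_fderiv_chartRead_iter_le_exp (k : ℕ)
    (hsb : SmallBelow (fun i => blockAvg (P := P) (j := i) (expMeanLogSU (n := Fin N))) k U₀) {A c : ℝ} (hA0 : 0 ≤ A) (hc : 0 ≤ c) {α : ℕ → ℝ} (hα : ∀ i, 0 ≤ α i)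
    (hone : ∀ i, i < k → ∀ Y : PBond P i → (specialUnitaryLogChart (Fin N)).lie,
      ∑ c' : PBond P (i + 1), ‖fderiv ℝ (fun (B : PBond P i → (specialUnitaryLogChart (Fin N)).lie) (c' : PBond P (i + 1)) => (isChartRep_specialUnitaryGroup (n := Fin N)).logChart (avgFun (expMeanLogSU (n := Fin N)) (fun c => (isChartRep_specialUnitaryGroup (n := Fin N)).expChart (B c) * Averaging.iter (fun i => blockAvg (P := P) (j := i) (expMeanLogSU (n := Fin N))) i U₀ c) c' * (avgFun (expMeanLogSU (n := Fin N)) (Averaging.iter (fun i => blockAvg (P := P) (j := i) (expMeanLogSU (n := Fin N))) i U₀) c')⁻¹)) 0 Y c'‖ ≤ A * (1 + c * α i) * ∑ c : PBond P i, ‖Y c‖)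
    (X : PBond P 0 → (specialUnitaryLogChart (Fin N)).lie) :
    ∑ B : PBond P k, ‖fderiv ℝ (fun (A : PBond P 0 → (specialUnitaryLogChart (Fin N)).lie) (c : PBond P k) => (isChartRep_specialUnitaryGroup (n := Fin N)).logChart (Averaging.iter (fun i => blockAvg (P := P) (j := i) (expMeanLogSU (n := Fin N))) k (fun b => (isChartRep_specialUnitaryGroup (n := Fin N)).expChart (A b) * U₀ b) c * (Averaging.iter (fun i => blockAvg (P := P) (j := i) (expMeanLogSU (n := Fin N))) k U₀ c)⁻¹)) 0 X B‖ ≤ A ^ k * Real.exp (c * ∑ i ∈ Finset.range k, α i) * ∑ b : PBond P 0, ‖X b‖ := by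
  have h := sum_norm_fderiv_chartRead_iter_le (P := P) (N := N) U₀ k hsb (A := fun i => A * (1 + c * α i))
    (fun i => mul_nonneg hA0 (by nlinarith [hα i])) hone X
  have hprod : ∏ i ∈ Finset.range k, A * (1 + c * α i) ≤ A ^ k * Real.exp (c * ∑ i ∈ Finset.range k, α i) := by
    rw [Finset.prod_mul_distrib, Finset.prod_const, Finset.card_range, Finset.mul_sum, Real.exp_sum]
    refine mul_le_mul_of_nonneg_left ?_ (pow_nonneg hA0 k)
    refine Finset.prod_le_prod (fun i _ => by nlinarith [hα i]) fun i _ => ?_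
    have := Real.add_one_le_exp (c * α i)
    linarith
  have hX0 : 0 ≤ ∑ b : PBond P 0, ‖X b‖ := Finset.sum_nonneg fun b _ => norm_nonneg _
  calc _ ≤ (∏ i ∈ Finset.range k, A * (1 + c * α i)) * ∑ b : PBond P 0, ‖X b‖ := h
    _ ≤ A ^ k * Real.exp (c * ∑ i ∈ Finset.range k, α i) * ∑ b : PBond P 0, ‖X b‖ := mul_le_mul_of_nonneg_right hprod hX0

end Product

end Summit.QuantumFields.YangMills.Theorems.FluctuationComparisonRegPrIntLS2BetaChartReadDerivKStepL1

end
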